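import Summits.AtomisticToContinuum.FouriersLaw.Theorems.PhononMeanFreePathIncoherentChannelLightConeHelper8

/-!
# Stub `stub_lightCone` of line `two-horizons-forecast-loss` (crux `PhononMeanFreePath.IncoherentChannel`)

Registered stub `stub_lightCone` of the lead's skeleton of crux stmt-AtomisticToContinuum-11811
(`Summit.AtomisticToContinuum.FouriersLaw.Theses.PhononMeanFreePath.IncoherentChannel`), proved with
exactly the registered signature: inside the window `t ≤ N^η` (`η < 1` fixed) the common-past part
`P_N(t) = commonPast` and the squared pair correlation `r_N(t)² = pairCorr²` are super-polynomially
small, `|P_N(t)| + r_N(t)² ≤ ε_N` with `N^{1+η} ε_N → 0`.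

**Proof (CAUSALITY).** By the reduction `lightCone_reduction` (the initial momentum `p₀` is an
independent `N(0,T)` under the Gibbs state, helper 1), `r_N² ≤ T·D_N(t)` and `|P_N| ≤ K √(D_N(t))`
with the single propagation functional `D_N(t) = E|v_t(z) - v_t(z̃)|²` (`z̃` = `z` with `p₀`
resampled, `v_t = K_t p_N` the mean forecast of the far momentum). By `lightCone_propagation_mean`
(pathwise light cone of the constructed Langevin flow with the same noise, helper 4, through the
lattice Grönwall hierarchy, helper 3; stationarity of both copies and the `N`-uniform Gibbs position
moments of all orders at all sites, helpers 5–7; Jensen in the noise, helper 8): for every `k`,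
`D_N(t) ≤ 4T e^{Λ}Λ^N/N! + C t^{2^k}√(N+1)/Λ^{2^k}` for all `Λ > 0`. Choosing `Λ = (N+1)/8` and
`2^k ≥ 5/(1-η)` gives, for `t ≤ N^η`, `D_N(t) ≤ B_N = 32T ρ^{N+1} + C 8^{2^k} (N+1)^{-(2^k(1-η) - 1/2)}`
with `ρ = e^{9/8}/8 < 1`, and `ε_N = K√(B_N) + T B_N` has `N^{1+η} ε_N → 0`.
-/

noncomputable section

namespace Summit.AtomisticToContinuum.FouriersLaw.Theorems.PhononMeanFreePath

open MeasureTheory Set Filter Topology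
open scoped NNReal
open Literature.MathematicalPhysics.KineticTheory.HeatConduction

/-! ### Elementary analysis for the two regimes -/

/-- `e^{9/8} < 8` (indeed `e^{9/8} ≤ e² < 2.72² < 8`). -/
theorem lightCone_exp_nine_eighths_lt : Real.exp (9 / 8) < 8 := by
  have h1 : Real.exp (9 / 8) ≤ Real.exp 2 := Real.exp_le_exp.2 (by norm_num)
  have h2 : Real.exp 2 = Real.exp 1 ^ 2 := by rw [← Real.exp_nat_mul]; norm_num
  have h3 := Real.exp_one_lt_d9
  have h4 : 0 < Real.exp 1 := Real.exp_pos 1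
  nlinarith

/-- **In-cone term**: with `Λ = (N+1)/8`, `e^{Λ} Λ^N / N! ≤ 8 ρ^{N+1}`, `ρ = e^{9/8}/8`
(`x^n/n! ≤ eˣ`). -/
theorem lightCone_inCone_le (N : ℕ) :
    Real.exp (((N : ℝ) + 1) / 8) * (((N : ℝ) + 1) / 8) ^ N / N.factorial ≤ 8 * (Real.exp (9 / 8) / 8) ^ (N + 1) := by
  have hN1 : (0 : ℝ) < (N : ℝ) + 1 := by positivity
  have hfac : (0 : ℝ) < N.factorial := by positivity
  -- `(N+1)^N / N! = (N+1)^{N+1}/(N+1)! ≤ e^{N+1}`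
  have h1 : ((N : ℝ) + 1) ^ N / N.factorial ≤ Real.exp ((N : ℝ) + 1) := by
    have h := Real.pow_div_factorial_le_exp ((N : ℝ) + 1) hN1.le (N + 1)
    have e : ((N : ℝ) + 1) ^ (N + 1) / ((N + 1).factorial : ℝ) = ((N : ℝ) + 1) ^ N / N.factorial := by
      rw [Nat.factorial_succ, pow_succ]
      push_cast
      field_simp
    rwa [e] at h
  have h2 : Real.exp (((N : ℝ) + 1) / 8) * (((N : ℝ) + 1) / 8) ^ N / N.factorial =
      Real.exp (((N : ℝ) + 1) / 8) / 8 ^ N * (((N : ℝ) + 1) ^ N / N.factorial) := by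
    rw [div_pow]; field_simp
  rw [h2]
  have h3 : Real.exp (((N : ℝ) + 1) / 8) / 8 ^ N * (((N : ℝ) + 1) ^ N / N.factorial) ≤
      Real.exp (((N : ℝ) + 1) / 8) / 8 ^ N * Real.exp ((N : ℝ) + 1) :=
    mul_le_mul_of_nonneg_left h1 (by positivity)
  refine h3.trans (le_of_eq ?_)
  rw [div_pow, ← Real.exp_nat_mul, div_mul_eq_mul_div, ← Real.exp_add, pow_succ]
  have e8 : (8 : ℝ) ^ N * 8 ≠ 0 := by positivity
  field_simp
  congr 1
  push_cast
  ring

/-- **Out-of-cone term** inside the window: for `0 ≤ t ≤ N^η`, `C ≥ 0`,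
`C t^M √(N+1) / ((N+1)/8)^M ≤ C 8^M (N+1)^{ηM + 1/2 - M}`. -/
theorem lightCone_outCone_le {C η t : ℝ} (hC : 0 ≤ C) (hη : 0 ≤ η) (N M : ℕ) (ht : 0 ≤ t) (htN : t ≤ (N : ℝ) ^ η) :
    C * t ^ M * Real.sqrt ((N : ℝ) + 1) / (((N : ℝ) + 1) / 8) ^ M ≤
      C * 8 ^ M * ((N : ℝ) + 1) ^ (η * M + 1 / 2 - M) := by
  have hN0 : (0 : ℝ) ≤ N := Nat.cast_nonneg N
  have hN1 : (0 : ℝ) < (N : ℝ) + 1 := by positivity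
  -- `t^M ≤ (N+1)^{ηM}`
  have h1 : t ^ M ≤ ((N : ℝ) + 1) ^ (η * M) := by
    calc t ^ M ≤ ((N : ℝ) ^ η) ^ M := pow_le_pow_left₀ ht htN M
      _ ≤ (((N : ℝ) + 1) ^ η) ^ M :=
          pow_le_pow_left₀ (Real.rpow_nonneg hN0 η) (Real.rpow_le_rpow hN0 (by linarith) hη) M
      _ = ((N : ℝ) + 1) ^ (η * M) := by rw [← Real.rpow_natCast, ← Real.rpow_mul hN1.le]
  have h2 : Real.sqrt ((N : ℝ) + 1) = ((N : ℝ) + 1) ^ (1 / 2 : ℝ) := Real.sqrt_eq_rpow _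
  have h3 : (((N : ℝ) + 1) / 8) ^ M = ((N : ℝ) + 1) ^ (M : ℝ) / 8 ^ M := by rw [div_pow, Real.rpow_natCast]
  rw [h2, h3, div_div_eq_mul_div]
  rw [div_le_iff₀ (Real.rpow_pos_of_pos hN1 _)]
  have e : C * 8 ^ M * ((N : ℝ) + 1) ^ (η * M + 1 / 2 - M) * ((N : ℝ) + 1) ^ (M : ℝ) =
      C * 8 ^ M * (((N : ℝ) + 1) ^ (η * M) * ((N : ℝ) + 1) ^ (1 / 2 : ℝ)) := by
    rw [mul_assoc (C * 8 ^ M), ← Real.rpow_add hN1, ← Real.rpow_add hN1]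
    congr 2; ring
  rw [e]
  have h4 : 0 ≤ ((N : ℝ) + 1) ^ (1 / 2 : ℝ) := Real.rpow_nonneg hN1.le _
  calc C * t ^ M * ((N : ℝ) + 1) ^ (1 / 2 : ℝ) * 8 ^ M = C * 8 ^ M * (t ^ M * ((N : ℝ) + 1) ^ (1 / 2 : ℝ)) := by ring
    _ ≤ C * 8 ^ M * (((N : ℝ) + 1) ^ (η * M) * ((N : ℝ) + 1) ^ (1 / 2 : ℝ)) :=
        mul_le_mul_of_nonneg_left (mul_le_mul_of_nonneg_right h1 h4) (by positivity)

/-- Polynomial times geometric tends to zero: `N^e ρ^{N+1} → 0` (`0 ≤ e ≤ 4`, `0 ≤ ρ < 1`). -/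
theorem lightCone_tendsto_rpow_mul_geom {e ρ : ℝ} (he : 0 ≤ e) (he4 : e ≤ 4) (h0 : 0 ≤ ρ) (h1 : ρ < 1) :
    Tendsto (fun N : ℕ => (N : ℝ) ^ e * ρ ^ (N + 1)) atTop (𝓝 0) := by
  have hg := tendsto_pow_const_mul_const_pow_of_abs_lt_one 4 (abs_lt.2 ⟨by linarith, h1⟩)
  have hg0 : Tendsto (fun N : ℕ => ρ ^ N) atTop (𝓝 0) := tendsto_pow_atTop_nhds_zero_of_lt_one h0 h1
  have hlim : Tendsto (fun N : ℕ => ρ * ((N : ℝ) ^ 4 * ρ ^ N) + ρ * ρ ^ N) atTop (𝓝 0) := by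
    have := (hg.const_mul ρ).add (hg0.const_mul ρ)
    simpa using this
  refine squeeze_zero (fun N => by positivity) (fun N => ?_) hlim
  -- `N^e ≤ N^4 + 1`
  have hN0 : (0 : ℝ) ≤ N := Nat.cast_nonneg N
  have hb : (N : ℝ) ^ e ≤ (N : ℝ) ^ 4 + 1 := by
    rcases Nat.eq_zero_or_pos N with hN | hN
    · subst hN
      rcases he.eq_or_lt with he0 | he0
      · rw [← he0]; simp
      · rw [Nat.cast_zero, Real.zero_rpow he0.ne']; norm_num
    · have h1N : (1 : ℝ) ≤ N := by exact_mod_cast hN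
      calc (N : ℝ) ^ e ≤ (N : ℝ) ^ (4 : ℝ) := Real.rpow_le_rpow_of_exponent_le h1N he4
        _ = (N : ℝ) ^ 4 := by rw [show (4 : ℝ) = ((4 : ℕ) : ℝ) by norm_num, Real.rpow_natCast]
        _ ≤ (N : ℝ) ^ 4 + 1 := by linarith
  calc (N : ℝ) ^ e * ρ ^ (N + 1) ≤ ((N : ℝ) ^ 4 + 1) * ρ ^ (N + 1) := mul_le_mul_of_nonneg_right hb (by positivity)
    _ = ρ * ((N : ℝ) ^ 4 * ρ ^ N) + ρ * ρ ^ N := by rw [pow_succ]; ring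

/-- Polynomial with negative total exponent tends to zero: `N^e (N+1)^{-s} → 0` for `0 ≤ e < s`. -/
theorem lightCone_tendsto_rpow_mul_rpow_neg {e s : ℝ} (he : 0 ≤ e) (hs : e < s) :
    Tendsto (fun N : ℕ => (N : ℝ) ^ e * ((N : ℝ) + 1) ^ (-s)) atTop (𝓝 0) := by
  have hlim : Tendsto (fun N : ℕ => ((N : ℝ) + 1) ^ (-(s - e))) atTop (𝓝 0) :=
    (tendsto_rpow_neg_atTop (by linarith : 0 < s - e)).comp
      (tendsto_atTop_add_const_right _ 1 tendsto_natCast_atTop_atTop)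
  refine squeeze_zero (fun N => by positivity) (fun N => ?_) hlim
  have hN0 : (0 : ℝ) ≤ N := Nat.cast_nonneg N
  have hN1 : (0 : ℝ) < (N : ℝ) + 1 := by positivity
  calc (N : ℝ) ^ e * ((N : ℝ) + 1) ^ (-s) ≤ ((N : ℝ) + 1) ^ e * ((N : ℝ) + 1) ^ (-s) :=
        mul_le_mul_of_nonneg_right (Real.rpow_le_rpow hN0 (by linarith) he) (Real.rpow_nonneg hN1.le _)
    _ = ((N : ℝ) + 1) ^ (-(s - e)) := by rw [← Real.rpow_add hN1]; congr 1; ring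

/-! ### The stub -/

/-- **Stub `stub_lightCone` (CAUSALITY: the far forecast does not feel `p₀` inside the cone).**
For the pinned anharmonic chain between Langevin baths at `T` (all parameters `> 0`) and every fixed
`0 < η < 1` there is `ε_N` with `N^{1+η} ε_N → 0` such that the common-past part and the squared
pair correlation satisfy `|P_N(t)| + r_N(t)² ≤ ε_N` for all `0 ≤ t ≤ N^η` — reduction to the
propagation functional (`lightCone_reduction`) and its super-polynomial smallness in Gibbs mean
(`lightCone_propagation_mean`), with `Λ = (N+1)/8` and `2^k ≥ 5/(1-η)`. -/
theorem stub_lightCone : ∀ ω₂ lam β γ : ℝ, 0 < ω₂ → 0 < lam → 0 < β → 0 < γ → ∀ T : ℝ, 0 < T → ∀ η : ℝ, 0 < η → η < 1 → ∃ ε : ℕ → ℝ, Tendsto (fun N : ℕ => (N : ℝ) ^ (1 + η) * ε N) atTop (𝓝 0) ∧ ∀ (N : ℕ) (t : ℝ), 0 ≤ t → t ≤ (N : ℝ) ^ η → |commonPast ω₂ lam β γ T N t| + (pairCorr ω₂ lam β γ T N t) ^ 2 ≤ ε N := by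
  intro ω₂ lam β γ hω hl hβ hγ T hT η hη hη1
  obtain ⟨K, hK0, hK⟩ := lightCone_reduction ω₂ lam β γ hω hl.le hβ.le hγ.le T hT
  -- the power `M = 2^k ≥ 5/(1-η)`
  obtain ⟨k, hk⟩ : ∃ k : ℕ, 5 / (1 - η) ≤ (2 : ℝ) ^ k := by
    obtain ⟨n, hn⟩ := exists_nat_ge (5 / (1 - η))
    refine ⟨n, hn.trans ?_⟩
    exact_mod_cast (Nat.lt_two_pow_self).le
  obtain ⟨C, hC0, hC⟩ := lightCone_propagation_mean ω₂ lam β γ hω hl.le hβ.le hγ.le T hT k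
  set M : ℕ := 2 ^ k with hMdef
  have hMη : 5 ≤ (M : ℝ) * (1 - η) := by
    have h1η : 0 < 1 - η := by linarith
    have : (5 : ℝ) / (1 - η) * (1 - η) = 5 := by field_simp
    have hM : ((M : ℕ) : ℝ) = (2 : ℝ) ^ k := by rw [hMdef]; push_cast; ring
    rw [hM]
    nlinarith
  -- the bound sequence
  set ρ : ℝ := Real.exp (9 / 8) / 8 with hρ
  have hρ0 : 0 ≤ ρ := by positivity
  have hρ1 : ρ < 1 := by rw [hρ, div_lt_one (by norm_num)]; exact lightCone_exp_nine_eighths_lt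
  set s : ℝ := (M : ℝ) * (1 - η) - 1 / 2 with hs
  have hs_exp : η * M + 1 / 2 - M = -s := by rw [hs]; ring
  set B : ℕ → ℝ := fun N => 32 * T * ρ ^ (N + 1) + C * 8 ^ M * ((N : ℝ) + 1) ^ (-s) with hB
  have hB0 : ∀ N, 0 ≤ B N := fun N => by positivity
  -- `D_N(t) ≤ B_N` inside the window
  have hDB : ∀ (N : ℕ) (t : ℝ), 0 ≤ t → t ≤ (N : ℝ) ^ η →
      ∫ x : PhaseSpace (N + 1) × ℝ, (fcast ω₂ lam β γ T N t x.1 -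
          fcast ω₂ lam β γ T N t ((x.1.1, Function.update x.1.2 0 x.2) : PhaseSpace (N + 1))) ^ 2
          ∂(((pinnedChain ω₂ lam β γ).gibbsMeasure (N + 1) T).prod (ProbabilityTheory.gaussianReal 0 T.toNNReal)) ≤ B N := by
    intro N t ht htN
    have hΛ : (0 : ℝ) < ((N : ℝ) + 1) / 8 := by positivity
    refine (hC N t ht _ hΛ).trans ?_
    have h1 : 4 * T * (Real.exp (((N : ℝ) + 1) / 8) * (((N : ℝ) + 1) / 8) ^ N / N.factorial) ≤ 32 * T * ρ ^ (N + 1) := by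
      have := mul_le_mul_of_nonneg_left (lightCone_inCone_le N) (by positivity : (0 : ℝ) ≤ 4 * T)
      rw [hρ]; linarith
    have h2 := lightCone_outCone_le hC0 hη.le N M ht htN
    rw [hs_exp] at h2
    exact add_le_add h1 h2
  -- `ε`
  refine ⟨fun N => K * Real.sqrt (B N) + T * B N, ?_, fun N t ht htN => ?_⟩
  · -- `N^{1+η} ε_N → 0`
    have hBt : ∀ e : ℝ, 0 ≤ e → e ≤ 4 → e < s → Tendsto (fun N : ℕ => (N : ℝ) ^ e * B N) atTop (𝓝 0) := by
      intro e he0 he4 hes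
      have hA := (lightCone_tendsto_rpow_mul_geom he0 he4 hρ0 hρ1).const_mul (32 * T)
      have hB' := (lightCone_tendsto_rpow_mul_rpow_neg he0 hes).const_mul (C * 8 ^ M)
      have := hA.add hB'
      simp only [mul_zero, add_zero] at this
      refine this.congr fun N => ?_
      simp only [hB]; ring
    have hs4 : 4 < s := by rw [hs]; linarith
    have e1 : ∀ N : ℕ, (N : ℝ) ^ (1 + η) * Real.sqrt (B N) = Real.sqrt ((N : ℝ) ^ (2 + 2 * η) * B N) := by
      intro N
      have hN0 : (0 : ℝ) ≤ N := Nat.cast_nonneg N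
      have hsq : Real.sqrt ((N : ℝ) ^ (2 + 2 * η)) = (N : ℝ) ^ (1 + η) := by
        rw [Real.sqrt_eq_rpow, ← Real.rpow_mul hN0]
        congr 1; ring
      rw [Real.sqrt_mul (Real.rpow_nonneg hN0 _), hsq]
    have hT1 : Tendsto (fun N : ℕ => Real.sqrt ((N : ℝ) ^ (2 + 2 * η) * B N)) atTop (𝓝 0) := by
      have := (hBt (2 + 2 * η) (by linarith) (by linarith) (by linarith)).sqrt
      rwa [Real.sqrt_zero] at this
    have hT2 := hBt (1 + η) (by linarith) (by linarith) (by linarith)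
    have := (hT1.const_mul K).add (hT2.const_mul T)
    simp only [mul_zero, add_zero] at this
    refine this.congr fun N => ?_
    rw [← e1]; ring
  · -- the bound
    obtain ⟨hr, hP⟩ := hK N t
    set D := ∫ x : PhaseSpace (N + 1) × ℝ, (fcast ω₂ lam β γ T N t x.1 -
        fcast ω₂ lam β γ T N t ((x.1.1, Function.update x.1.2 0 x.2) : PhaseSpace (N + 1))) ^ 2
        ∂(((pinnedChain ω₂ lam β γ).gibbsMeasure (N + 1) T).prod (ProbabilityTheory.gaussianReal 0 T.toNNReal)) with hD
    have hDB' : D ≤ B N := hDB N t ht htN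
    have h1 : K * Real.sqrt D ≤ K * Real.sqrt (B N) := mul_le_mul_of_nonneg_left (Real.sqrt_le_sqrt hDB') hK0
    have h2 : T * D ≤ T * B N := mul_le_mul_of_nonneg_left hDB' hT.le
    linarith

end Summit.AtomisticToContinuum.FouriersLaw.Theorems.PhononMeanFreePath

end
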